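import Summits.AtomisticToContinuum.FouriersLaw.Theorems.HiddenChargeMazurOddChargeAlgebraToolkit
import Summits.AtomisticToContinuum.FouriersLaw.Theorems.HiddenChargeMazurOddChargeAlgebraProjections

/-!
# Odd conservation laws of the pinned anharmonic chain — symbol calculus, monomial bookkeeping

Support bookkeeping for the symbol calculus of `N ∘ L₊` on left-aligned polynomials of pure class
`(s, d)` (minimal site `0`, maximal site `s`, momentum degree `d`): the expansion
`L₊ g = A⁺ g + Σ_x F⁺_x ∂_{p_x} g`, the splitting of the quartic force
`F⁺_x = -(λ + 2β) q_x³ + β Φ(q_{x+1}, q_x) + β Φ(q_{x-1}, q_x)` (`Φ = cub`), and the class of every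
resulting term: `A⁺ g` has class `(s, d+1)`, `q_x³ ∂_{p_x} g` class `(s, d-1)`, the interaction terms
have sites in `[0, s]` except the two boundary terms `Φ(q_{s+1}, q_s) ∂_{p_s} g` (class `(s+1, d-1)`)
and `Φ(q_{-1}, q_0) ∂_{p_0} g` (minimal site `-1`, its shift has class `(s+1, d-1)`). [folklore]
-/

noncomputable section

open MvPolynomial Finsupp
open scoped BigOperators Pointwise

namespace Summit.AtomisticToContinuum.FouriersLaw.Theorems.OddChargeAlgebra

/-! ## Expansion of the derivation `A⁺` (translations and `shift` lemmas are in the Toolkit) -/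

/-- Evaluation of a finite sum of derivations. [folklore] -/
theorem derivation_sum_apply {ι : Type*} (S : Finset ι) (Dv : ι → Derivation ℝ R R) (a : R) :
    (∑ i ∈ S, Dv i) a = ∑ i ∈ S, Dv i a := by
  induction S using Finset.cons_induction with
  | empty => simp
  | cons i S hi ih => rw [Finset.sum_cons, Finset.sum_cons, Derivation.add_apply, ih]

/-- `A⁺ = Σ_x p_x ∂_{q_x}` on polynomials living on the sites of `I`. [folklore] -/
theorem Aplus_eq_sum (I : Finset ℤ) {g : R} (hg : g ∈ supported ℝ (Var.site ⁻¹' (I : Set ℤ))) :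
    Aplus g = ∑ x ∈ I, X (Sum.inr x) * pderiv (Sum.inl x) g := by
  set D₂ : Derivation ℝ R R := ∑ x ∈ I, (X (Sum.inr x) : R) • pderiv (Sum.inl x) with hD₂
  have key : Aplus g = D₂ g := by
    refine derivation_eqOn_supported (fun v hv => ?_) hg
    simp only [Set.mem_preimage, Finset.mem_coe] at hv
    simp only [Function.comp_apply, hD₂, derivation_sum_apply, Derivation.smul_apply, smul_eq_mul,
      pderiv_X]
    rcases v with y | y
    · simp only [Aplus, mkDerivation_X, Sum.elim_inl]
      rw [Finset.sum_eq_single_of_mem y hv fun x _ hxy => by simp [hxy]]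
      simp
    · simp [Aplus, mkDerivation_X]
  rw [key, hD₂, derivation_sum_apply]
  simp only [Derivation.smul_apply, smul_eq_mul]

/-- The monomial expansion of `cub q_u q_w`. [folklore] -/
theorem cub_X_X_eq (u w : Var) : cub (X u) (X w) =
    (monomial (single u 3) 1 - monomial (single u 2 + single w 1) 3
      + monomial (single u 1 + single w 2) 3 : R) := by
  have h1 : (monomial (single u 3) 1 : R) = X u ^ 3 := (X_pow_eq_monomial).symm
  have h2 : (monomial (single u 2 + single w 1) 3 : R) = 3 * X u ^ 2 * X w := by
    rw [monomial_single_add, ← C_mul_X_pow_eq_monomial, pow_one, map_ofNat]; ring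
  have h3 : (monomial (single u 1 + single w 2) 3 : R) = 3 * X u * X w ^ 2 := by
    rw [monomial_single_add, ← C_mul_X_pow_eq_monomial, pow_one, map_ofNat]; ring
  rw [h1, h2, h3, cub]

/-! ## Supports -/

/-- Support of a sum of exponent vectors. [folklore] -/
theorem mem_support_add_iff {a b : Var →₀ ℕ} {v : Var} :
    v ∈ (a + b).support ↔ v ∈ a.support ∨ v ∈ b.support := by
  simp only [Finsupp.mem_support_iff, Finsupp.add_apply, ne_eq]
  omega

/-- Sites of a product of monomials. [folklore] -/
theorem msites_add (a b : Var →₀ ℕ) : msites (a + b) = msites a ∪ msites b := by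
  ext x
  simp only [mem_msites, Finset.mem_union, mem_support_add_iff]
  constructor
  · rintro ⟨v, hv | hv, rfl⟩
    · exact Or.inl ⟨v, hv, rfl⟩
    · exact Or.inr ⟨v, hv, rfl⟩
  · rintro (⟨v, hv, rfl⟩ | ⟨v, hv, rfl⟩)
    · exact ⟨v, Or.inl hv, rfl⟩
    · exact ⟨v, Or.inr hv, rfl⟩

/-- Sites of a pure power. [folklore] -/
theorem msites_single {v : Var} {k : ℕ} (hk : k ≠ 0) : msites (single v k) = {Var.site v} := by
  simp [msites, Finsupp.support_single _ hk]

/-- Monomials with the same sites have the same minimal site. [folklore] -/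
theorem minsite_congr {n m : Var →₀ ℕ} (h : msites n = msites m) : minsite n = minsite m := by
  simp only [minsite, h]

/-- Monomials with the same sites have the same maximal site. [folklore] -/
theorem maxsite_congr {n m : Var →₀ ℕ} (h : msites n = msites m) : maxsite n = maxsite m := by
  simp only [maxsite, h]

/-- Monomials of a product. [folklore] -/
theorem exists_of_mem_support_mul {p q : R} {n : Var →₀ ℕ} (hn : n ∈ (p * q).support) :
    ∃ a ∈ p.support, ∃ b ∈ q.support, a + b = n := by
  classical
  exact Finset.mem_add.mp (support_mul p q hn)

/-- Monomials of a partial derivative. [folklore] -/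
theorem mem_support_of_mem_support_pderiv {v : Var} {g : R} {b : Var →₀ ℕ}
    (hb : b ∈ (pderiv v g).support) : b + single v 1 ∈ g.support := by
  rw [MvPolynomial.mem_support_iff, coeff_pderiv] at hb
  rw [MvPolynomial.mem_support_iff]
  exact fun h => hb (by rw [h, zero_mul])

/-- Monomials of a finite sum. [folklore] -/
theorem exists_of_mem_support_sum {ι : Type*} {S : Finset ι} {F : ι → R} {n : Var →₀ ℕ}
    (hn : n ∈ (∑ i ∈ S, F i).support) : ∃ i ∈ S, n ∈ (F i).support := by
  classical
  exact Finset.mem_biUnion.mp (MvPolynomial.support_sum hn)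

/-- The monomials of `cub q_u q_w`. [folklore] -/
theorem mem_support_cub {u w : Var} {a : Var →₀ ℕ} (ha : a ∈ (cub (X u) (X w) : R).support) :
    a = single u 3 ∨ a = single u 2 + single w 1 ∨ a = single u 1 + single w 2 := by
  classical
  rw [cub_X_X_eq] at ha
  rcases Finset.mem_union.mp (MvPolynomial.support_add ha) with ha | ha
  · rcases Finset.mem_union.mp (MvPolynomial.support_sub Var _ _ ha) with ha | ha
    · exact Or.inl (Finset.mem_singleton.mp (support_monomial_subset ha))
    · exact Or.inr (Or.inl (Finset.mem_singleton.mp (support_monomial_subset ha)))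
  · exact Or.inr (Or.inr (Finset.mem_singleton.mp (support_monomial_subset ha)))

/-- What the symbol calculus needs about the monomials of `cub q_x q_y`: they involve only `q_x`
and `q_y`, always involve `q_x`, and carry no momentum. [folklore] -/
theorem cub_support_facts {x y : ℤ} {a : Var →₀ ℕ}
    (ha : a ∈ (cub (X (Sum.inl x)) (X (Sum.inl y)) : R).support) :
    (∀ v ∈ a.support, v = Sum.inl x ∨ v = Sum.inl y) ∧ Sum.inl x ∈ a.support ∧ weight pwt a = 0 := by
  rcases mem_support_cub ha with rfl | rfl | rfl
  · refine ⟨fun v hv => Or.inl (Finset.mem_singleton.mp (support_single_subset hv)), ?_, ?_⟩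
    · simp
    · simp [weight_single, pwt]
  · refine ⟨fun v hv => ?_, ?_, ?_⟩
    · rcases mem_support_add_iff.mp hv with hv | hv
      · exact Or.inl (Finset.mem_singleton.mp (support_single_subset hv))
      · exact Or.inr (Finset.mem_singleton.mp (support_single_subset hv))
    · exact mem_support_add_iff.mpr (Or.inl (by simp))
    · simp [weight_single, pwt]
  · refine ⟨fun v hv => ?_, ?_, ?_⟩
    · rcases mem_support_add_iff.mp hv with hv | hv
      · exact Or.inl (Finset.mem_singleton.mp (support_single_subset hv))
      · exact Or.inr (Finset.mem_singleton.mp (support_single_subset hv))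
    · exact mem_support_add_iff.mpr (Or.inl (by simp))
    · simp [weight_single, pwt]

/-! ## Pure classes -/

/-- A polynomial of pure class `(s, d)` lives on the sites `[0, s]`. [folklore] -/
theorem site_mem_Icc_of_pure {g : R} {s : ℤ} {d : ℕ}
    (hg : ∀ n ∈ g.support, minsite n = 0 ∧ maxsite n = s ∧ weight pwt n = d)
    {n : Var →₀ ℕ} (hn : n ∈ g.support) {v : Var} (hv : v ∈ n.support) :
    Var.site v ∈ Set.Icc (0 : ℤ) s :=
  ⟨(hg n hn).1 ▸ minsite_le_site hv, (hg n hn).2.1 ▸ site_le_maxsite hv⟩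

/-- A polynomial of pure class `(s, d)` is supported on `Var.site ⁻¹' [0, s]`. [folklore] -/
theorem mem_supported_of_pure {g : R} {s : ℤ} {d : ℕ}
    (hg : ∀ n ∈ g.support, minsite n = 0 ∧ maxsite n = s ∧ weight pwt n = d) :
    g ∈ supported ℝ (Var.site ⁻¹' ((Finset.Icc 0 s : Finset ℤ) : Set ℤ)) := by
  refine mem_supported_of_site_mem fun n hn v hv => ?_
  rw [Finset.coe_Icc]
  exact site_mem_Icc_of_pure hg hn hv

/-- A polynomial of pure class is left-aligned. [folklore] -/
theorem nf_eq_self_of_pure {g : R} {s : ℤ} {d : ℕ}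
    (hg : ∀ n ∈ g.support, minsite n = 0 ∧ maxsite n = s ∧ weight pwt n = d) : nf g = g :=
  nf_eq_self_of fun n hn => Or.inr (hg n hn).1

/-- Bookkeeping for a monomial `b` of `∂_v g`, `g` of pure class `(s, d)`: the sites of `b` lie in
`[0, s]`, `b` still touches site `0` (resp. `s`) unless `v` sits there, and the momentum degrees
add up. [folklore] -/
theorem pderiv_support_facts {g : R} {s : ℤ} {d : ℕ}
    (hg : ∀ n ∈ g.support, minsite n = 0 ∧ maxsite n = s ∧ weight pwt n = d)
    {b : Var →₀ ℕ} {v : Var} (hm : b + single v 1 ∈ g.support) :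
    (∀ w ∈ b.support, Var.site w ∈ Set.Icc (0 : ℤ) s) ∧ Var.site v ∈ Set.Icc (0 : ℤ) s ∧
      (Var.site v ≠ 0 → ∃ w ∈ b.support, Var.site w = 0) ∧
      (Var.site v ≠ s → ∃ w ∈ b.support, Var.site w = s) ∧ weight pwt b + pwt v = d := by
  have hvm : v ∈ (b + single v 1).support := mem_support_add_iff.mpr (Or.inr (by simp))
  have hm0 : b + single v 1 ≠ 0 := by rintro h; simp [h] at hvm
  obtain ⟨h0, hs, hd⟩ := hg _ hm
  refine ⟨fun w hw => site_mem_Icc_of_pure hg hm (mem_support_add_iff.mpr (Or.inl hw)),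
    site_mem_Icc_of_pure hg hm hvm, fun hv0 => ?_, fun hvs => ?_, ?_⟩
  · obtain ⟨w, hw, hw'⟩ := exists_site_eq_minsite hm0
    rw [h0] at hw'
    rcases mem_support_add_iff.mp hw with hw | hw
    · exact ⟨w, hw, hw'⟩
    · exact absurd ((Finset.mem_singleton.mp (support_single_subset hw)) ▸ hw') hv0
  · obtain ⟨w, hw, hw'⟩ := exists_site_eq_maxsite hm0
    rw [hs] at hw'
    rcases mem_support_add_iff.mp hw with hw | hw
    · exact ⟨w, hw, hw'⟩
    · exact absurd ((Finset.mem_singleton.mp (support_single_subset hw)) ▸ hw') hvs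
  · rw [map_add, weight_single, one_smul] at hd
    exact hd

/-! ## Classes of the terms of `L₊ g` -/

/-- `Var.site` on positions. [folklore] -/
@[simp] theorem site_inl (x : ℤ) : Var.site (Sum.inl x) = x := rfl

/-- `Var.site` on momenta. [folklore] -/
@[simp] theorem site_inr (x : ℤ) : Var.site (Sum.inr x) = x := rfl

/-- `A⁺ g` has class `(s, d+1)` if `g` has class `(s, d)`. [folklore] -/
theorem pure_Aplus : ∀ {g : R} {s : ℤ} {d : ℕ},
    (∀ n ∈ g.support, minsite n = 0 ∧ maxsite n = s ∧ Finsupp.weight pwt n = d) →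
    ∀ n ∈ (Aplus g).support, minsite n = 0 ∧ maxsite n = s ∧ Finsupp.weight pwt n = d + 1 := by
  intro g s d hg n hn
  rw [Aplus_eq_sum _ (mem_supported_of_pure hg)] at hn
  obtain ⟨x, -, hn⟩ := exists_of_mem_support_sum hn
  rw [support_X_mul, Finset.mem_map] at hn
  obtain ⟨b, hb, rfl⟩ := hn
  rw [addLeftEmbedding_apply]
  have hm := mem_support_of_mem_support_pderiv hb
  obtain ⟨h0, h1, h2⟩ := hg _ hm
  have hs : msites (single (Sum.inr x) 1 + b) = msites (b + single (Sum.inl x) 1) := by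
    rw [msites_add, msites_add, msites_single one_ne_zero, msites_single one_ne_zero,
      Finset.union_comm, site_inl, site_inr]
  refine ⟨(minsite_congr hs).trans h0, (maxsite_congr hs).trans h1, ?_⟩
  rw [map_add, weight_single] at h2 ⊢
  simp only [pwt, Sum.elim_inl, Sum.elim_inr, smul_eq_mul, mul_zero, mul_one, add_zero] at h2 ⊢
  omega

/-- The pinning term `q_x³ ∂_{p_x} g` has class `(s, d-1)`. [folklore] -/
theorem pure_X_pow_mul_pderiv {g : R} {s : ℤ} {d : ℕ}
    (hg : ∀ n ∈ g.support, minsite n = 0 ∧ maxsite n = s ∧ weight pwt n = d) (x : ℤ) :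
    ∀ n ∈ (X (Sum.inl x) ^ 3 * pderiv (Sum.inr x) g : R).support,
      minsite n = 0 ∧ maxsite n = s ∧ weight pwt n + 1 = d := by
  intro n hn
  rw [X_pow_eq_monomial] at hn
  obtain ⟨a, ha, b, hb, rfl⟩ := exists_of_mem_support_mul hn
  obtain rfl : a = single (Sum.inl x) 3 := Finset.mem_singleton.mp (support_monomial_subset ha)
  have hm := mem_support_of_mem_support_pderiv hb
  obtain ⟨h0, h1, h2⟩ := hg _ hm
  have hs : msites (single (Sum.inl x) 3 + b) = msites (b + single (Sum.inr x) 1) := by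
    rw [msites_add, msites_add, msites_single three_ne_zero, msites_single one_ne_zero,
      Finset.union_comm, site_inl, site_inr]
  refine ⟨(minsite_congr hs).trans h0, (maxsite_congr hs).trans h1, ?_⟩
  rw [map_add, weight_single] at h2 ⊢
  simp only [pwt, Sum.elim_inl, Sum.elim_inr, smul_eq_mul, mul_zero, mul_one, zero_add] at h2 ⊢
  omega

/-- Bookkeeping for the interaction terms `cub q_u q_w · ∂_{p_x} g`, `g` of class `(s, d)`. [folklore] -/
theorem cub_mul_pderiv_facts {g : R} {s : ℤ} {d : ℕ}
    (hg : ∀ n ∈ g.support, minsite n = 0 ∧ maxsite n = s ∧ weight pwt n = d) (u w x : ℤ) :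
    ∀ n ∈ (cub (X (Sum.inl u)) (X (Sum.inl w)) * pderiv (Sum.inr x) g : R).support,
      (∀ v ∈ n.support, Var.site v = u ∨ Var.site v = w ∨ Var.site v ∈ Set.Icc (0 : ℤ) s) ∧
      (∃ v ∈ n.support, Var.site v = u) ∧
      (x ≠ 0 → ∃ v ∈ n.support, Var.site v = 0) ∧
      (x ≠ s → ∃ v ∈ n.support, Var.site v = s) ∧
      (s = 0 → 2 ≤ d → ∃ v ∈ n.support, Var.site v = 0) ∧
      x ∈ Set.Icc (0 : ℤ) s ∧ weight pwt n + 1 = d := by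
  intro n hn
  obtain ⟨a, ha, b, hb, rfl⟩ := exists_of_mem_support_mul hn
  obtain ⟨ha1, ha2, ha3⟩ := cub_support_facts ha
  have hm := mem_support_of_mem_support_pderiv hb
  obtain ⟨hb1, hv, hb2, hb3, hbd⟩ := pderiv_support_facts hg hm
  refine ⟨fun v hv' => ?_, ⟨Sum.inl u, mem_support_add_iff.mpr (Or.inl ha2), rfl⟩, fun hx => ?_,
    fun hx => ?_, fun hs0 hd2 => ?_, hv, ?_⟩
  · rcases mem_support_add_iff.mp hv' with h | h
    · rcases ha1 v h with rfl | rfl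
      · exact Or.inl rfl
      · exact Or.inr (Or.inl rfl)
    · exact Or.inr (Or.inr (hb1 v h))
  · obtain ⟨w', hw', h'⟩ := hb2 hx
    exact ⟨w', mem_support_add_iff.mpr (Or.inr hw'), h'⟩
  · obtain ⟨w', hw', h'⟩ := hb3 hx
    exact ⟨w', mem_support_add_iff.mpr (Or.inr hw'), h'⟩
  · have hb0 : b ≠ 0 := by
      rintro rfl
      simp [pwt] at hbd
      omega
    obtain ⟨w', hw'⟩ := Finsupp.support_nonempty_iff.mpr hb0
    refine ⟨w', mem_support_add_iff.mpr (Or.inr hw'), ?_⟩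
    have := hb1 w' hw'
    rw [hs0, Set.mem_Icc] at this
    omega
  · rw [map_add, ha3, zero_add]
    simpa [pwt] using hbd

/-- The interaction terms live on a window of sites containing `q_u`, `q_w` and `[0, s]`. [folklore] -/
theorem sites_cub_mul_pderiv {g : R} {s : ℤ} {d : ℕ}
    (hg : ∀ n ∈ g.support, minsite n = 0 ∧ maxsite n = s ∧ weight pwt n = d) {u w a b : ℤ}
    (hu : u ∈ Set.Icc a b) (hw : w ∈ Set.Icc a b) (ha : a ≤ 0) (hb : s ≤ b) (x : ℤ) :
    ∀ n ∈ (cub (X (Sum.inl u)) (X (Sum.inl w)) * pderiv (Sum.inr x) g : R).support,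
      ∀ v ∈ n.support, Var.site v ∈ Set.Icc a b := by
  intro n hn v hv
  obtain ⟨h1, -⟩ := cub_mul_pderiv_facts hg u w x n hn
  rcases h1 v hv with h | h | h
  · exact h ▸ hu
  · exact h ▸ hw
  · exact ⟨ha.trans h.1, h.2.trans hb⟩

/-- The interaction terms have momentum degree `d - 1`. [folklore] -/
theorem weight_cub_mul_pderiv {g : R} {s : ℤ} {d : ℕ}
    (hg : ∀ n ∈ g.support, minsite n = 0 ∧ maxsite n = s ∧ weight pwt n = d) (u w x : ℤ) :
    ∀ n ∈ (cub (X (Sum.inl u)) (X (Sum.inl w)) * pderiv (Sum.inr x) g : R).support,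
      weight pwt n + 1 = d :=
  fun n hn => (cub_mul_pderiv_facts hg u w x n hn).2.2.2.2.2.2

/-- The right boundary term `cub q_{s+1} q_s · ∂_{p_s} g` has class `(s+1, d-1)` (for `s ≥ 1`, or
momentum degree `d ≥ 2`). [folklore] -/
theorem pure_cubPlus {g : R} {s : ℤ} {d : ℕ}
    (hg : ∀ n ∈ g.support, minsite n = 0 ∧ maxsite n = s ∧ weight pwt n = d) (hsd : 1 ≤ s ∨ 2 ≤ d) :
    ∀ n ∈ (cub (X (Sum.inl (s + 1))) (X (Sum.inl s)) * pderiv (Sum.inr s) g : R).support,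
      minsite n = 0 ∧ maxsite n = s + 1 ∧ weight pwt n + 1 = d := by
  intro n hn
  obtain ⟨h1, h2, h3, -, h5, h6, h7⟩ := cub_mul_pderiv_facts hg (s + 1) s s n hn
  rw [Set.mem_Icc] at h6
  refine ⟨minsite_eq_of ?_ fun v hv => ?_, maxsite_eq_of h2 fun v hv => ?_, h7⟩
  · by_cases hs0 : s = 0
    · rcases hsd with hs1 | hd2
      · omega
      · exact h5 hs0 hd2
    · exact h3 hs0
  · rcases h1 v hv with h | h | h
    · omega
    · omega
    · exact h.1
  · rcases h1 v hv with h | h | h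
    · omega
    · omega
    · exact h.2.trans (by omega)

/-- The left boundary term `cub q_{-1} q_0 · ∂_{p_0} g` has minimal site `-1`, maximal site `s`
and momentum degree `d - 1` (for `s ≥ 1`, or momentum degree `d ≥ 2`). [folklore] -/
theorem cubMinus_facts {g : R} {s : ℤ} {d : ℕ}
    (hg : ∀ n ∈ g.support, minsite n = 0 ∧ maxsite n = s ∧ weight pwt n = d) (hsd : 1 ≤ s ∨ 2 ≤ d) :
    ∀ n ∈ (cub (X (Sum.inl (-1))) (X (Sum.inl 0)) * pderiv (Sum.inr 0) g : R).support,
      minsite n = -1 ∧ maxsite n = s ∧ weight pwt n + 1 = d := by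
  intro n hn
  obtain ⟨h1, h2, -, h4, h5, h6, h7⟩ := cub_mul_pderiv_facts hg (-1) 0 0 n hn
  rw [Set.mem_Icc] at h6
  refine ⟨minsite_eq_of h2 fun v hv => ?_, maxsite_eq_of ?_ fun v hv => ?_, h7⟩
  · rcases h1 v hv with h | h | h
    · omega
    · omega
    · exact le_trans (by norm_num) h.1
  · by_cases hs0 : s = 0
    · rcases hsd with hs1 | hd2
      · omega
      · rw [hs0]; exact h5 hs0 hd2
    · exact h4 (Ne.symm hs0)
  · rcases h1 v hv with h | h | h
    · omega
    · omega
    · exact h.2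

end Summit.AtomisticToContinuum.FouriersLaw.Theorems.OddChargeAlgebra

end
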